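import Summits.Ventures.CertifiedManyBodySolver.Certificates.SymRungW3Box2d3.Cert
import Summits.Ventures.CertifiedManyBodySolver.Statement

/-!
# The rung «W3BOX» as an M3 lower energy ROW (stmt-Ventures-22024 vocabulary)

`Summit.Ventures.CertifiedManyBodySolver.M3EnergyLowerRow 0 lo` (Statement.lean) is the predicate the crux
`Theses.M3x2EdgeSplit.LowerEdge_ge_m83o100 = ∃ lo, −83/100 ≤ lo ∧ M3EnergyLowerRow 0 lo` quantifies over.  The kernel-replayed
word-form certificate `Certificates.SymRungW3Box2d3.cert` (team lb-sym: checker T1–T10 by hub-lb-sym-plan-1 / hub-lb-sym-eng-3,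
certificate by hub-lb-sym-eng-4 g1, comparator hub-lb-sym-ref-2) gives an UNCONDITIONAL inhabitant of that predicate at
`lo = −618858676065167666234883/2⁷⁹ ≈ −1.0238` — 0.19 short of the crux's `−83/100`, so this is a rung, not the edge: it supports the item
without closing it.  Computational grade: the proof term depends on the two `native_decide` evaluations of the certificate module.
No summit statement is proved here; nothing here predicts superconductivity.
-/

namespace Summit.Ventures.CertifiedManyBodySolver.Theorems

open Literature.MathematicalPhysics.QuantumLattice.ThermodynamicLimit

/-- **M3 lower row at `t' = 0` from the replayed rung certificate**: `e₀(t=1, t'=0, U=8, n=7/8) ≥ −618858676065167666234883/2⁷⁹`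
(`≈ −1.0238158`), unconditionally (computational grade). -/
theorem m3_tp0_lowerRow_w3box :
    M3EnergyLowerRow 0 ((-618858676065167666234883 : ℚ) / 604462909807314587353088) := by
  have h := Certificates.SymRungW3Box2d3.energyDensityTT'_ge_symValue
  rw [Certificates.SymRungW3Box2d3.cert_value] at h
  exact h

/-- The same row in the `∃`-shape of the crux, with the rung's (insufficient) constant: `∃ lo ≥ −1.0239` such that the row holds —
recorded to make the remaining gap to `LowerEdge_ge_m83o100` (`−83/100 ≤ lo`) explicit. -/
theorem exists_m3_tp0_lowerRow_ge_m1p0239 :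
    ∃ lo : ℚ, (-1.0239 : ℚ) ≤ lo ∧ M3EnergyLowerRow 0 lo :=
  ⟨(-618858676065167666234883 : ℚ) / 604462909807314587353088, by norm_num, m3_tp0_lowerRow_w3box⟩

end Summit.Ventures.CertifiedManyBodySolver.Theorems
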